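import Mathlib
import HarnessLib
import HarnessLib.Audit
import Summits.HodgeConjecture.HodgeConjecture.Theses.BoundaryReadout
import Literature.AlgebraicGeometry.HodgeTheory.HodgeTypeExteriorProduct

/-!
# Line `birth` — BC3 skeleton for the crux `BoundarySupply` (stmt-HodgeConjecture-15912)

Route `BoundaryReadout` (route-HodgeConjecture-BoundaryReadout), crux of rank 2 `BoundarySupply`: every rational
`(p,p)`-class `c` on a smooth projective complex variety `X` is `e^*(ξ|_{X_t})` for a `ℂ`-morphism
`e : X ⟶ X_t` into a smooth projective fibre of some `f : 𝒳 ⟶ C` (`𝒳` smooth projective, `C` a smooth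
projective curve, `f` surjective) carrying a global rational `(p,p)`-class `ξ`, such that the fibre over some
`o ∈ C(ℂ)` is COVERED by finitely many smooth projective `Y_i ⟶ X_o` with every `ξ|_{Y_i}` ABSOLUTE HODGE.

THE LINE = the route header's own reading of the crux ("the class is driven, inside its Hodge locus, to a
fibre covered by pieces where absoluteness is already known — dim ≤ 3, uniruled fourfolds, abelian type,
cellular/toric, HC-known"; "trivially true where `c` is already known absolute — constant family"; card
`boundary-principle-b-cusp-readout` K2 CUSP SUPPLY / K3 CUSP DESCENT "hypothesis free when: components have
cycle-spanned `H^{2k}` …; dim `Y_i ≤ 3`; uniruled fourfold components; abelian type"), cut into THREE pieces of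
three different kinds — a geometric supply statement, an arithmetic statement about cycle classes, and a
construction on the tree's carriers — so that absoluteness of `ξ|_{Y_i}` is never asserted directly but
DERIVED from the TYPE of the pieces:

* `stub_boundaryDichotomy : BoundaryDichotomy` — CUSP SUPPLY ONTO PIECES OF KNOWN TYPE (the geometric heart; the
  movable/rigid dichotomy of the route's two-layer plan phrased by outcome): every rational `(p,p)`-class `c` on a
  smooth projective `X` is EITHER absolute Hodge outright (the rigid / dark sector, where the route header says
  "the statement is their absoluteness outright") OR is carried — `c = e^*(ξ|_{X_t})`, same family data as the
  crux — by a family whose fibre `X_o` is covered by finitely many smooth projective pieces `Y_i` of KNOWN TYPE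
  in degree `2p`: every rational `(p,p)`-class on `Y_i` is ALGEBRAIC or ABSOLUTE HODGE (HC-known pieces: dim
  `≤ 3`, cellular/toric strata of LCS points, uniruled fourfolds in degree 4; absoluteness-known pieces: abelian
  type). The condition is on the PIECES, not on `ξ` — that is what makes boundaries a supply.
* `stub_cycleClassesAbsolute : CycleClassesAbsolute` — CYCLE CLASSES ARE ABSOLUTE HODGE (Deligne 1982
  Ex. 2.1(a); Charles–Schnell §11.2.2 after Def. 11.2.3), on the tree's de Rham `IsAbsoluteHodgeClass`: a
  rational `(p,p)`-class lying in `algebraicClasses X p = Nᵖ H²ᵖ` is absolute Hodge. Theorem in print,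
  unformalised; it is exactly the explicit hypothesis `hAH` under which the landed Negative lemmas
  `Theorems/BallQuotientHodgeAbsolute/Negative/HodgeImpliesAbsoluteHodge` work, so a proof serves the tree twice.
* `stub_absoluteSupply : AbsoluteSupply` — CONSTANT-FAMILY SUPPLY: an absolute Hodge class is supplied (the
  crux's conclusion for `c` absolute: `𝒳 = X × ℙ¹ ⟶ ℙ¹`, `o = t`, one piece `Y = X ≅ X_o`, `ξ = pr₁^* c`,
  `e : X ≅ X_t`). Mathematically folklore; on the tree's carriers it needs products of smooth projective
  varieties (Segre), fibres of a projection, and functoriality of rational / `(p,p)` classes — size L.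
* `BoundarySupply_of : AbsoluteSupply → BoundaryDichotomy → CycleClassesAbsolute → BoundarySupply` — THE skeleton
  theorem, a REAL proof (no sorry): case on the dichotomy; the absolute case is `AbsoluteSupply`; in the boundary
  case keep the family data and, for each piece, `ξ|_{Y_i} = (g_i ≫ ι_o)^* ξ` is rational
  (`IsRationalClass.pullback`, PROVED tree theorem) and of type `(p,p)` on `Y_i`
  (`IsOfHodgeType.map_of_isSmoothProjective`, PROVED tree theorem, Voisin I §7.3.2), hence algebraic-or-absolute
  by the type of the piece, and algebraic ⇒ absolute is `CycleClassesAbsolute`. Every stub is used.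
  `BoundarySupply_of_stubs : BoundarySupply` instantiates it (the hypothesis-free target the skeleton audit keys on).

`sorry` occurs ONLY in the three `stub_*` theorems (audit: 3 sorries = 3 stubs, zero elsewhere). Honest status: the
open-problem content of the crux sits in `stub_boundaryDichotomy` (as it must: the crux is ONE supply assertion;
what the cut buys is that its two escape hatches — absolute outright, or pieces of known type — are each served by
a separately attackable lemma of a different kind); `stub_boundaryDichotomy` is implied by Conj. 11.2.17 (left
disjunct) hence HC-safe granted `CycleClassesAbsolute` (`boundaryDichotomy_of_hodgeConjecture`, sorry-free, §4;
the crux itself is HC-safe granted stubs 1 + 3, §4 `example`s);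
`stub_cycleClassesAbsolute` is a theorem in print; `stub_absoluteSupply` is folklore. None implies the crux or the
summit cheaply — BC3 probes (seat folder `bc/probe_<Stub>.lean`, one tactic per `example`, `maxHeartbeats 400000`):
for each stub `S`, `S → BoundarySupply` and `S → HodgeConjecture` by each of `exact?`, `simpa [S]`, `unfold S; simpa`,
`aesop`, `unfold S T; exact?`, `unfold S T; aesop` — 36/36 FAIL (23 clean failures: `exact?` could not close the goal /
aesop exhaustive search failed / assumption failed; 13 heartbeat time-outs in `whnf`/`isDefEq` on the `∃`-block), and
the combined recipe `first | exact? | simpa [S] | (unfold S; simpa) | aesop` 12/12 FAIL (`bc/BoundarySupply_probes.lean`):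
stub 1 supplies only absolute classes, stub 2 needs stubs 1 + 3 and the functoriality theorems to become the crux,
stub 3 supplies no family.

Disproof used: `Cruxes/BoundarySupply/` had no workfile before this one (no `Disproof.lean`, no
`_false_without_` theorem, no landed `Theorems/BoundarySupply/Negative/*`). Checked against the landed Negative
lemmas nearest in kind, `Theorems/BallQuotientHodgeAbsolute/Negative/*` (refuter lane of the dropped crux
"Hodge ⇒ absolute Hodge on ball quotients"): (i) `not_hodgeConjecture_of_exists_not_isAbsoluteHodgeClass` — granted
cycle classes absolute, a non-absolute Hodge class refutes HC: consistent, it is why stub 2's left disjunct is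
HC-safe; (ii) `isAbsoluteHodgeClass_zero_iff` / `nonempty_conjugationChart_of_isAbsoluteHodgeClass` — any proof of
absoluteness must BUILD conjugation charts for every `σ ∈ Aut ℂ` (even for `c = 0`): honoured and LOCALISED —
the line's absoluteness obligations sit exactly in `stub_cycleClassesAbsolute` (cycle classes, where
Charles–Schnell's algebraic definition of the cycle class is the printed chart argument) and in the two escape
hatches of `stub_boundaryDichotomy` (its left disjunct = Conj. 11.2.17 for that one class, the dark sector; and
absoluteness-known pieces, e.g. abelian type via Deligne 1982 Thm 2.11), so the chart-building lower bound is
charged to the stubs that can pay it; `BoundarySupply_of` itself builds no chart. Negatives index (3 entries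
2026-08-17: MilnorKExponential symbol lift, DerivedTorelliFermat K3 multisets, ELineTransport matrices): no stub
is an instance.
-/

-- `Summit.<Summit>.<Problem>`: for the single-conjunct summit the duplicate `HodgeConjecture.HodgeConjecture` is mandated.
set_option linter.dupNamespace false
set_option linter.unusedVariables false

namespace Summit.HodgeConjecture.HodgeConjecture.Cruxes.BoundarySupply.Birth

open CategoryTheory

-- The stub STATEMENTS (§1) are written FULLY QUALIFIED on purpose: a prover must be able to restate their text
-- verbatim in a Theorems file importing only the BoundaryReadout route (+ Mathlib/Literature).

/-! ## §1 The stub STATEMENTS (named Props = the admissible hypotheses of `BoundarySupply_of`) -/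

/-- **Statement of stub 1 — constant-family supply of absolute classes.** For `X` smooth projective of
dimension `n` and `c ∈ H²ᵖ(X(ℂ);ℂ)` an ABSOLUTE HODGE class, the conclusion of `BoundarySupply` holds for `c`
(verbatim the crux's `∃`-block). Intended witness: `𝒳 = X × ℙ¹`, `C = ℙ¹`, `f = pr₂`, `o = t`, `ι = Unit`,
`Y = X` with `g : X ≅ X_o`, `ξ = pr₁^* c`, `e : X ≅ X_t`; then `ξ|_Y = c` is absolute by hypothesis and
`e^*(ξ|_{X_t}) = c` by functoriality. Why plausibly true: folklore. Why it might fail (formally): only if the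
tree's `IsSmoothProjective` is not closed under `× ℙ¹` (Segre embedding, smoothness and geometric
irreducibility of products — all in print, Hartshorne II Ex. 5.11, III.10.1) or fibres of `pr₂` over
`ℂ`-points are not identified with `X`. Size: L (products and projections on `Over (Spec ℂ)`).
[cite: Hartshorne1977, II Ex. 5.11 and III Prop. 10.1] [cite: VoisinHodgeI2002, §7.3.2] -/
-- @[stub "birth"]  (gate-reserved attribute: refused in crux workfiles, hence a comment in this tree copy)
def AbsoluteSupply : Prop :=
  ∀ ⦃n : ℕ⦄ ⦃X : Literature.AlgebraicGeometry.Motives.SchemeOver ℂ⦄,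
    Literature.AlgebraicGeometry.Motives.IsSmoothProjective n X →
    ∀ (p : ℕ) (c : Literature.AlgebraicGeometry.HodgeTheory.complexBetti X (2 * p)),
      Literature.AlgebraicGeometry.HodgeTheory.IsAbsoluteHodgeClass n X p c →
      ∃ (N : ℕ) (𝒳 C : Literature.AlgebraicGeometry.Motives.SchemeOver ℂ) (f : 𝒳 ⟶ C)
        (o t : Literature.AlgebraicGeometry.Motives.AlgPoints C ℂ) (ι : Type) (_ : Finite ι) (m : ι → ℕ)
        (Y : ι → Literature.AlgebraicGeometry.Motives.SchemeOver ℂ)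
        (g : ∀ i, Y i ⟶ Literature.AlgebraicGeometry.Motives.fiberOver f o)
        (ξ : Literature.AlgebraicGeometry.HodgeTheory.complexBetti 𝒳 (2 * p)) (n' : ℕ)
        (e : X ⟶ Literature.AlgebraicGeometry.Motives.fiberOver f t),
        Literature.AlgebraicGeometry.Motives.IsSmoothProjective N 𝒳 ∧
        Literature.AlgebraicGeometry.Motives.IsSmoothProjective 1 C ∧
        Function.Surjective f.left.base ∧
        (∀ i, Literature.AlgebraicGeometry.Motives.IsSmoothProjective (m i) (Y i)) ∧
        (∀ x : ↥(Literature.AlgebraicGeometry.Motives.fiberOver f o).left,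
          ∃ (i : ι) (y : ↥(Y i).left), (g i).left.base y = x) ∧
        Literature.AlgebraicGeometry.HodgeTheory.IsRationalClass ξ ∧
        Literature.AlgebraicGeometry.HodgeTheory.IsOfHodgeType N 𝒳 (2 * p) p p ξ ∧
        (∀ i, Literature.AlgebraicGeometry.HodgeTheory.IsAbsoluteHodgeClass (m i) (Y i) p
          (Literature.AlgebraicGeometry.HodgeTheory.complexBetti.map
            (CategoryTheory.CategoryStruct.comp (g i) (Literature.AlgebraicGeometry.Motives.fiberι f o))
            (2 * p) ξ)) ∧
        Literature.AlgebraicGeometry.Motives.IsSmoothProjective n'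
          (Literature.AlgebraicGeometry.Motives.fiberOver f t) ∧
        Literature.AlgebraicGeometry.HodgeTheory.complexBetti.map e (2 * p)
          (Literature.AlgebraicGeometry.HodgeTheory.complexBetti.map
            (Literature.AlgebraicGeometry.Motives.fiberι f t) (2 * p) ξ) = c

/-- **Statement of stub 2 — boundary dichotomy: cusp supply onto pieces of KNOWN TYPE.** For `X` smooth
projective of dimension `n` and a rational `(p,p)`-class `c ∈ H²ᵖ(X(ℂ);ℂ)`: EITHER `c` is absolute Hodge, OR
there are `f : 𝒳 ⟶ C` (`𝒳` smooth projective, `C` a smooth projective curve, `f` surjective on points),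
`o t ∈ C(ℂ)`, a global rational `(p,p)`-class `ξ` on `𝒳`, a smooth projective fibre `X_t` with `e : X ⟶ X_t`
and `e^*(ξ|_{X_t}) = c`, and finitely many smooth projective `Y_i ⟶ X_o` covering the fibre over `o`, each of
KNOWN TYPE in degree `2p`: every rational `(p,p)`-class on `Y_i` is algebraic (`∈ algebraicClasses (Y i) p`) or
absolute Hodge. (The family block is the crux's, with the conjunct "`ξ|_{Y_i}` absolute" replaced by this
condition on the PIECES.) Why plausibly true: it is the route's supply programme verbatim — Hodge-locus arcs
(algebraic: Cattani–Deligne–Kaplan) compactified to curves `C`, the class globalised on the smooth projective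
total space by the theorem of the fixed part + semisimplicity (Deligne, Hodge II 4.1.1; Voisin 2007 Lemma 2.4),
ending at Tyurin / large-complex-structure boundaries of Calabi–Yau loci (arXiv:1601.08110, arXiv:2404.12422),
`d`-planes points of surface loci, toroidal cusps, Kulikov fibres — whose components are of dimension `≤ 3`,
cellular/toric, uniruled fourfolds (degree-4 HC, Conte–Murre / Bloch–Srinivas) or of abelian type (Deligne
1982 Thm 2.11); and classically implied by Charles–Schnell Conj. 11.2.17 (left disjunct), so HC-safe granted
`CycleClassesAbsolute` (`boundaryDichotomy_of_hodgeConjecture`, §4). Why it might fail: rigid classes (isolated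
in their Hodge locus) sit only in isotrivial families, where the statement is their absoluteness outright (left
disjunct = the dark case); movable loci may reach only boundaries carrying a full-dimensional component of
unknown type (e.g. general-type surfaces of `p_g ≥ 2`, CY₃ × CY₃ projectors) — then only an induction through
partial cusps (card K3) could rescue it. Size: XL (open problem; the geometric heart of the crux).
[cite: Voisin2007HodgeLoci, Lemma 2.4] [cite: CattaniDeligneKaplan1995JAMS, Thm 1.1]
[cite: Deligne1982HodgeCycles, Thm 2.11] [cite: ConteMurre1978, Thm] -/
-- @[stub "birth"]  (gate-reserved attribute: refused in crux workfiles, hence a comment in this tree copy)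
def BoundaryDichotomy : Prop :=
  ∀ ⦃n : ℕ⦄ ⦃X : Literature.AlgebraicGeometry.Motives.SchemeOver ℂ⦄,
    Literature.AlgebraicGeometry.Motives.IsSmoothProjective n X →
    ∀ (p : ℕ) (c : Literature.AlgebraicGeometry.HodgeTheory.complexBetti X (2 * p)),
      Literature.AlgebraicGeometry.HodgeTheory.IsRationalClass c →
      Literature.AlgebraicGeometry.HodgeTheory.IsOfHodgeType n X (2 * p) p p c →
      Literature.AlgebraicGeometry.HodgeTheory.IsAbsoluteHodgeClass n X p c ∨
      ∃ (N : ℕ) (𝒳 C : Literature.AlgebraicGeometry.Motives.SchemeOver ℂ) (f : 𝒳 ⟶ C)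
        (o t : Literature.AlgebraicGeometry.Motives.AlgPoints C ℂ) (ι : Type) (_ : Finite ι) (m : ι → ℕ)
        (Y : ι → Literature.AlgebraicGeometry.Motives.SchemeOver ℂ)
        (g : ∀ i, Y i ⟶ Literature.AlgebraicGeometry.Motives.fiberOver f o)
        (ξ : Literature.AlgebraicGeometry.HodgeTheory.complexBetti 𝒳 (2 * p)) (n' : ℕ)
        (e : X ⟶ Literature.AlgebraicGeometry.Motives.fiberOver f t),
        Literature.AlgebraicGeometry.Motives.IsSmoothProjective N 𝒳 ∧
        Literature.AlgebraicGeometry.Motives.IsSmoothProjective 1 C ∧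
        Function.Surjective f.left.base ∧
        (∀ i, Literature.AlgebraicGeometry.Motives.IsSmoothProjective (m i) (Y i)) ∧
        (∀ x : ↥(Literature.AlgebraicGeometry.Motives.fiberOver f o).left,
          ∃ (i : ι) (y : ↥(Y i).left), (g i).left.base y = x) ∧
        Literature.AlgebraicGeometry.HodgeTheory.IsRationalClass ξ ∧
        Literature.AlgebraicGeometry.HodgeTheory.IsOfHodgeType N 𝒳 (2 * p) p p ξ ∧
        (∀ (i : ι) (d : Literature.AlgebraicGeometry.HodgeTheory.complexBetti (Y i) (2 * p)),
          Literature.AlgebraicGeometry.HodgeTheory.IsRationalClass d →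
          Literature.AlgebraicGeometry.HodgeTheory.IsOfHodgeType (m i) (Y i) (2 * p) p p d →
          d ∈ Literature.AlgebraicGeometry.HodgeTheory.algebraicClasses (Y i) p ∨
            Literature.AlgebraicGeometry.HodgeTheory.IsAbsoluteHodgeClass (m i) (Y i) p d) ∧
        Literature.AlgebraicGeometry.Motives.IsSmoothProjective n'
          (Literature.AlgebraicGeometry.Motives.fiberOver f t) ∧
        Literature.AlgebraicGeometry.HodgeTheory.complexBetti.map e (2 * p)
          (Literature.AlgebraicGeometry.HodgeTheory.complexBetti.map
            (Literature.AlgebraicGeometry.Motives.fiberι f t) (2 * p) ξ) = c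

/-- **Statement of stub 3 — cycle classes are absolute Hodge.** For `X` smooth projective of dimension `n`, a
rational `(p,p)`-class `c ∈ H²ᵖ(X(ℂ);ℂ)` lying in `algebraicClasses X p` (the `ℂ`-span `Nᵖ H²ᵖ(X(ℂ);ℂ)` of the
classes supported in codimension `≥ p`, i.e. of cycle classes) is an absolute Hodge class in the tree's de Rham
sense (`IsAbsoluteHodgeClass`: for every `σ ∈ Aut ℂ` a conjugate exists and every conjugate is
`(2πi/σ(2πi))ᵖ ·` a rational `(p,p)`-class on `X^σ`). Why plausibly true: theorem in print — "the cohomology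
class of an algebraic cycle is an absolute Hodge class" (Charles–Schnell §11.2.2, after Def. 11.2.3: the cycle
class is defined algebraically, `[Z]^σ = (2πi/σ(2πi))ᵖ [Z^σ]`; Deligne 1982, Ex. 2.1(a)). Why it might fail
(formally): the tree's conclusion quantifies over ALL `ConjugationChart`s, so the proof must build charts for
every `σ` (Jouanolou cover + analytifications + natural rational de Rham family) and prove single-valuedness of
chart conjugation (Grothendieck's comparison on the affine chart) — the lower bound recorded by the landed
Negative lemmas `BallQuotientHodgeAbsolute/Negative/{HodgeImpliesAbsoluteHodge, ChartConjugationUniqueness}`;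
and rationality of `c` is a genuine hypothesis (`algebraicClasses` is a `ℂ`-span). Size: L/XL (unformalised
theorem; the same statement is the hypothesis `hAH` of those Negative lemmas).
[cite: CharlesSchnell2014Notes, §11.2.2 (after Def. 11.2.3)] [cite: Deligne1982HodgeCycles, Ex. 2.1(a)] -/
-- @[stub "birth"]  (gate-reserved attribute: refused in crux workfiles, hence a comment in this tree copy)
def CycleClassesAbsolute : Prop :=
  ∀ ⦃n : ℕ⦄ ⦃X : Literature.AlgebraicGeometry.Motives.SchemeOver ℂ⦄,
    Literature.AlgebraicGeometry.Motives.IsSmoothProjective n X →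
    ∀ (p : ℕ) (c : Literature.AlgebraicGeometry.HodgeTheory.complexBetti X (2 * p)),
      Literature.AlgebraicGeometry.HodgeTheory.IsRationalClass c →
      Literature.AlgebraicGeometry.HodgeTheory.IsOfHodgeType n X (2 * p) p p c →
      c ∈ Literature.AlgebraicGeometry.HodgeTheory.algebraicClasses X p →
      Literature.AlgebraicGeometry.HodgeTheory.IsAbsoluteHodgeClass n X p c

/-! ## §2 The three registered stubs (`sorry` lives ONLY here) -/

/-- **Stub 1** — `AbsoluteSupply` (statement, witness, risks and sources: its docstring above): the
constant-family supply of absolute classes. [cite: Hartshorne1977, II Ex. 5.11 and III Prop. 10.1] -/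
theorem stub_absoluteSupply : AbsoluteSupply := by
  sorry

/-- **Stub 2** — `BoundaryDichotomy` (statement, mechanism, risks and sources: its docstring above): the
HARDEST stub, the geometric heart of the crux — every Hodge class is absolute outright or is driven inside its
Hodge locus to a fibre covered by pieces of known type. [cite: Voisin2007HodgeLoci, Lemma 2.4]
[cite: CattaniDeligneKaplan1995JAMS, Thm 1.1] -/
theorem stub_boundaryDichotomy : BoundaryDichotomy := by
  sorry

/-- **Stub 3** — `CycleClassesAbsolute` (statement, risks and sources: its docstring above): cycle classes are
absolute Hodge. [cite: CharlesSchnell2014Notes, §11.2.2 (after Def. 11.2.3)]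
[cite: Deligne1982HodgeCycles, Ex. 2.1(a)] -/
theorem stub_cycleClassesAbsolute : CycleClassesAbsolute := by
  sorry

/-! ## §3 The composition: the three stubs prove the crux BY NAME (sorry-free) -/

/-- **THE SKELETON THEOREM** (BC3 shape `stub₁-sig → stub₂-sig → stub₃-sig → crux`, conclusion = the route decl
`Summit.HodgeConjecture.HodgeConjecture.Theses.BoundaryReadout.BoundarySupply` BY NAME). Real proof: given
`(X, c)`, case on `BoundaryDichotomy`. Absolute case: `AbsoluteSupply`. Boundary case: keep the family data
`(N, 𝒳, C, f, o, t, ι, m, Y, g, ξ, n', e)`; for each piece, `ξ|_{Y_i} = (g_i ≫ ι_o)^* ξ` is rational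
(`IsRationalClass.pullback`) and of type `(p,p)` on the smooth projective `Y_i`
(`IsOfHodgeType.map_of_isSmoothProjective`), hence algebraic or absolute by the type of the piece, and in the
algebraic case absolute by `CycleClassesAbsolute`. [folklore] -/
theorem BoundarySupply_of :
    AbsoluteSupply → BoundaryDichotomy → CycleClassesAbsolute →
    Summit.HodgeConjecture.HodgeConjecture.Theses.BoundaryReadout.BoundarySupply := by
  intro hA hD hZ n X hX p c hc hpp
  unfold AbsoluteSupply at hA
  unfold BoundaryDichotomy at hD
  unfold CycleClassesAbsolute at hZ
  rcases hD hX p c hc hpp with habs |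
    ⟨N, 𝒳, C, f, o, t, ι, hι, m, Y, g, ξ, n', e, h𝒳, hC, hf, hY, hcov, hξr, hξh, hpieces, ht, hc'⟩
  · -- the rigid / dark sector: `c` is absolute outright, supplied by the constant family
    exact hA hX p c habs
  · -- the boundary sector: same family, absoluteness of `ξ|_{Y_i}` read off the TYPE of the pieces
    refine ⟨N, 𝒳, C, f, o, t, ι, hι, m, Y, g, ξ, n', e, h𝒳, hC, hf, hY, hcov, hξr, hξh, fun i => ?_, ht, hc'⟩
    -- `ξ|_{Y_i}` is rational …
    have hr : Literature.AlgebraicGeometry.HodgeTheory.IsRationalClass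
        (Literature.AlgebraicGeometry.HodgeTheory.complexBetti.map
          (g i ≫ Literature.AlgebraicGeometry.Motives.fiberι f o) (2 * p) ξ) :=
      hξr.pullback (Literature.AlgebraicGeometry.Motives.AlgPoints.mapContinuous (L := ℂ)
        (g i ≫ Literature.AlgebraicGeometry.Motives.fiberι f o))
    -- … and of type `(p,p)` on the smooth projective piece `Y_i` (Voisin I §7.3.2, PROVED in the tree)
    have hh : Literature.AlgebraicGeometry.HodgeTheory.IsOfHodgeType (m i) (Y i) (2 * p) p p
        (Literature.AlgebraicGeometry.HodgeTheory.complexBetti.map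
          (g i ≫ Literature.AlgebraicGeometry.Motives.fiberι f o) (2 * p) ξ) :=
      hξh.map_of_isSmoothProjective (hY i) h𝒳 _
    rcases hpieces i _ hr hh with halg | habs'
    · -- HC-known piece: the class is algebraic, hence absolute (cycle classes are absolute Hodge)
      exact hZ (hY i) p _ hr hh halg
    · -- absoluteness-known piece
      exact habs'

/-- **Registered target of the skeleton** — the crux BY NAME with NO hypotheses: `BoundarySupply_of` applied to the
three declared stubs (the crux modulo exactly the registered stubs; `#print axioms` reaches `sorryAx` precisely
through the three `stub_*`, so it is NOT a proof of the item and closes nothing until the stubs land). [folklore] -/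
theorem BoundarySupply_of_stubs :
    Summit.HodgeConjecture.HodgeConjecture.Theses.BoundaryReadout.BoundarySupply :=
  BoundarySupply_of stub_absoluteSupply stub_boundaryDichotomy stub_cycleClassesAbsolute

/-! ## §4 Recorded relations (sorry-free): where the stubs sit -/

/-- `S → stub 2` granted stub 3 (recorded converse probe): the Hodge conjecture and "cycle classes are absolute
Hodge" give the LEFT disjunct of `BoundaryDichotomy` for every class — stub 2 is HC-safe granted stub 3 (it can
fail only together with Charles–Schnell Conj. 11.2.17). [cite: CharlesSchnell2014Notes, §11.2.5 Conj. 11.2.17] -/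
theorem boundaryDichotomy_of_hodgeConjecture (hZ : CycleClassesAbsolute) (h : _root_.HodgeConjecture) :
    BoundaryDichotomy :=
  fun _n _X hX p c hc hpp => Or.inl (hZ hX p c hc hpp ((h hX).2 p c hc hpp))

/-- The crux from Conj. 11.2.17 (recorded relation, an `example` so that exactly one named theorem shape concludes
the crux): if EVERY rational `(p,p)`-class on every smooth projective complex variety is absolute Hodge
(Charles–Schnell Conj. 11.2.17, spelled out — not a tree constant), then `AbsoluteSupply` alone gives
`BoundarySupply` — the formal content of the route header's remark "trivially true where `c` is already known
absolute — constant family — so its content is exactly the classes not known absolute".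
[cite: CharlesSchnell2014Notes, §11.2.5 Conj. 11.2.17] -/
example (hA : AbsoluteSupply)
    (h17 : ∀ ⦃n : ℕ⦄ ⦃X : Literature.AlgebraicGeometry.Motives.SchemeOver ℂ⦄,
      Literature.AlgebraicGeometry.Motives.IsSmoothProjective n X →
      ∀ (p : ℕ) (c : Literature.AlgebraicGeometry.HodgeTheory.complexBetti X (2 * p)),
        Literature.AlgebraicGeometry.HodgeTheory.IsRationalClass c →
        Literature.AlgebraicGeometry.HodgeTheory.IsOfHodgeType n X (2 * p) p p c →
        Literature.AlgebraicGeometry.HodgeTheory.IsAbsoluteHodgeClass n X p c) :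
    Summit.HodgeConjecture.HodgeConjecture.Theses.BoundaryReadout.BoundarySupply :=
  fun _n _X hX p c hc hpp => hA hX p c (h17 hX p c hc hpp)

/-- `S → crux` granted stubs 1 + 3 (recorded converse probe, an `example`): the Hodge conjecture makes every
rational `(p,p)`-class algebraic, `CycleClassesAbsolute` makes it absolute, `AbsoluteSupply` supplies it — so the
crux is a CONSEQUENCE of the summit modulo two printed theorems (it is HC-safe, as the route header says), and it
is used TOWARD the summit through the route's `closes`. Not a cheap implication: both auxiliary statements are
open in the tree (BC3 probes `stub → crux` fail). [cite: CharlesSchnell2014Notes, §11.2.5 Conj. 11.2.17] -/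
example (hA : AbsoluteSupply) (hZ : CycleClassesAbsolute) (h : _root_.HodgeConjecture) :
    Summit.HodgeConjecture.HodgeConjecture.Theses.BoundaryReadout.BoundarySupply :=
  fun _n _X hX p c hc hpp => hA hX p c (hZ hX p c hc hpp ((h hX).2 p c hc hpp))

end Summit.HodgeConjecture.HodgeConjecture.Cruxes.BoundarySupply.Birth
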